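import Literature.NumberTheory.EllipticCurves.ManinConstantQuadraticTwistIstarProofs
import Literature.NumberTheory.EllipticCurves.IsogenyQuadraticTwistProofs
import Literature.NumberTheory.EllipticCurves.QuadraticTwistLocalPolynomialTwoProofs
import Literature.NumberTheory.EllipticCurves.IsogenyConductorModularityProofs
import Literature.NumberTheory.EllipticCurves.ManinConstantClassCertificateTwist
import Summits.BirchSwinnertonDyer.BirchSwinnertonDyer.Theorems.ManinLocalTwoThreeManinPrimeToThreeAtNineTwistCovered
import Summits.BirchSwinnertonDyer.BirchSwinnertonDyer.Theses.ManinLocalTwoThree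

/-!
# Route `ManinLocalTwoThree`, crux C3 `ManinPrimeToThreeAtNine` (stmt-BirchSwinnertonDyer-22968), line
# `ternary-twist` (-imc g8): STUB 1 `stub_ternaryTwistConductor` PROVED, and the odd-prime twist
# certificate with an isogenous witness and NO side conditions (line prover p1; `--supports`)

Theorems only (no definition, no named fact, no `sorry`). The Modularity Theorem `exists_isNewformOf`
and the three printed semistable-prime Manin facts are HYPOTHESES exactly as in the crux.

* `stub_ternaryTwistConductor` — VERBATIM the signature of STUB 1 of the line `ternary-twist`
  (HOME/imc/lines/line_C3_ternary_twist.lean, da6060bd8f38f37a): `hnf →` for `W ∼ W' ⊗ ℚ(√−3)` with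
  `9 ∤ N(W')` and `W` additive at `3`, `N(W') ∣ N(W)`. Reduced to the landed lemma
  `maninLocalTwoThree_conductorNorm_dvd_of_isIsogenous_twist_negThree` (which takes a datum and
  `9 ∣` level): pass to a global minimal model `C • W` (`hasGlobalMinimalModel_rat_holds`; conductor and
  isogeny class unchanged), take its datum at the conductor from modularity
  (`nonempty_modularParametrizationData_iff_exists_isNewformOf_unconditional`), and read `9 ∣ N(W)` off
  the additivity hypothesis (`sq_dvd_conductorNorm_of_not_good_of_not_mult`).
* `not_dvd_maninConstant_of_isIsogenous_twist_of_not_sq_dvd` — for ANY odd prime `q`: a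
  lattice-optimal `X₀(N)`-datum `D` of a globally minimal `W` with `q² ∣ N` and ANY elliptic `W'`
  (any model) with `W ∼ W' ⊗ χ_{q*}`, `q² ∤ N(W')` has `q ∤ c`. Compared with the tree's
  `not_dvd_maninConstant_of_isTwistOfSemistableAt_gamma0` the binders `N(W') ∣ N(W)`, «`W` additive
  at `q`», «`W'` globally minimal» are DISCHARGED: `W ⊗ χ_{q*} ∼ (W' ⊗ χ_{q*}) ⊗ χ_{q*} ≅ W'`
  (`IsIsogenous.quadraticTwist`, Cremona §3.9; `exists_quadraticTwist_quadraticTwist_eq_smul`), the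
  conductor is an isogeny invariant granted modularity (`conductorNorm_eq_of_isIsogenous_of_modularity`),
  so `f_q(W ⊗ χ_{q*}) ≤ 1` and the tree's WITNESS-FREE certificate
  `not_dvd_maninConstant_of_isSemistableAt_quadraticTwist_pStar` applies. (Serves the residual C5 at
  `q ≥ 5` as well as C3 at `q = 3`; the `q = 3` instance with the birth-line binders is the landed
  `maninLocalTwoThree_maninPrimeToThreeAtNine_twistCovered`, not restated here.)

BSD is not proved by this file; Manin's conjecture at `3` is not proved by this file.
-/

set_option autoImplicit false
set_option linter.dupNamespace false

noncomputable section

open scoped MatrixGroups ModularForm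

open CongruenceSubgroup WeierstrassCurve IsDedekindDomain Rat.HeightOneSpectrum
  Literature.NumberTheory.EllipticCurves Literature.NumberTheory.EllipticCurves.ModularForms

namespace Summit.BirchSwinnertonDyer.BirchSwinnertonDyer.Theorems.ManinLocalTwoThree

/-! ### STUB 1 of the line `ternary-twist` -/

/-- **`stub_ternaryTwistConductor` (line `ternary-twist`, STUB 1), PROVED** — verbatim the
registered-shape signature: granted modularity, if `W ∼ W' ⊗ ℚ(√−3)` with `9 ∤ N(W')` and `W` additive
at `3`, then `N(W') ∣ N(W)` (`χ₋₃` is unramified off `3`, so the exponents agree there; at `3`,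
`f₃(W') ≤ 1 < 2 ≤ f₃(W)`). [cite: SilvermanATAEC1994, IV.9.4 (PDF pp. 344–346)]
[cite: DiamondShurman2005, Thm. 8.8.1] -/
theorem stub_ternaryTwistConductor :
    exists_isNewformOf →
    ∀ {W : WeierstrassCurve ℚ} [W.IsElliptic] {W' : WeierstrassCurve ℚ} [W'.IsElliptic]
      [W'.IsGloballyMinimal], IsIsogenous W (W'.quadraticTwist ((-3 : ℤ) : ℚ)) →
      ¬ 3 ^ 2 ∣ W'.conductorNorm ℤ →
      (¬ W.HasGoodReductionAtPrime 3 ∧ ¬ W.HasMultiplicativeReductionAtPrime 3) →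
      W'.conductorNorm ℤ ∣ W.conductorNorm ℤ := by
  intro hnf W _ W' _ _ htw h9' hadd
  haveI : Fact (Nat.Prime 3) := ⟨Nat.prime_three⟩
  -- `9 ∣ N(W)` from additivity at `3`
  have h9 : 3 ^ 2 ∣ W.conductorNorm ℤ := sq_dvd_conductorNorm_of_not_good_of_not_mult hadd
  -- a global minimal model `C • W` and its datum at the conductor (modularity)
  obtain ⟨C, hC⟩ := hasGlobalMinimalModel_rat_holds W
  haveI := hC
  haveI : NeZero ((C • W).conductorNorm ℤ) := ⟨(conductorNorm_pos_holds (C • W)).ne'⟩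
  have hmod : nonempty_modularParametrizationData :=
    nonempty_modularParametrizationData_iff_exists_isNewformOf_unconditional.mpr hnf
  obtain ⟨D⟩ := hmod (C • W)
  have hNC : (C • W).conductorNorm ℤ = W.conductorNorm ℤ := conductorNorm_smul_rat W C
  have htw' : IsIsogenous (C • W) (W'.quadraticTwist ((-3 : ℤ) : ℚ)) :=
    (isIsogenous_of_smul W C).trans' htw
  have h := maninLocalTwoThree_conductorNorm_dvd_of_isIsogenous_twist_negThree hnf D htw'
    (hNC ▸ h9) h9'
  rwa [hNC] at h

/-! ### The odd-prime twist certificate with an isogenous witness, no side conditions -/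

/-- **`q ∤ c₀(𝒜)` when `𝒜 ∼ 𝒜' ⊗ χ_{q*}` with `q² ∤ N(𝒜')`, `q` odd** (isogenous witness; no
`N(W') ∣ N(W)`, no additivity hypothesis, `W'` any model). For a lattice-optimal `X₀(N)`-datum `D`
of the globally minimal `W` with `q² ∣ N`: `q ∤ D.maninConstant`. Proof: `W ⊗ χ_{q*} ∼
(W' ⊗ χ_{q*}) ⊗ χ_{q*} ≅ W'` (twisting commutes with isogeny, Cremona §3.9; a double twist is a
change of variables), so `N(W ⊗ χ_{q*}) = N(W')` (isogeny invariance of the conductor from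
modularity) and `f_q ≤ 1` there: the twist of `W` itself is semistable at `q`, which is the hypothesis
of the tree's `not_dvd_maninConstant_of_isSemistableAt_quadraticTwist_pStar`.
[cite: Stevens1989, Lemmas (5.2), (5.4)] [cite: Cesnavicius2018, Thm. 1.2] [cite: Mazur1978, Cor. 4.1]
[cite: CremonaAlgorithms1997, §3.9 (p. 87)] [cite: AtkinLehner1970, Thm. 4] -/
theorem not_dvd_maninConstant_of_isIsogenous_twist_of_not_sq_dvd
    (hM : mazur_not_dvd_maninConstant_of_odd)
    (hAU : abbesUllmo_not_dvd_maninConstant_of_not_dvd_level)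
    (hC2 : cesnavicius_not_two_dvd_maninConstant_of_two_dvd_level) (hnf : exists_isNewformOf)
    {q : ℕ} (hq : q.Prime) (hq2 : q ≠ 2)
    (W : WeierstrassCurve ℚ) [W.IsElliptic] [W.IsGloballyMinimal] {N : ℕ} [NeZero N]
    (D : ModularParametrizationData W N)
    (hopt : ∀ z ∈ D.L.lattice, ∃ w ∈ periodLattice D.f, z = D.c * w) (hqN : q ^ 2 ∣ N)
    (W' : WeierstrassCurve ℚ) [W'.IsElliptic]
    (hiso : IsIsogenous W (W'.quadraticTwist (((-1 : ℤ) ^ (q / 2) * q : ℤ) : ℚ)))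
    (hqN' : ¬ q ^ 2 ∣ W'.conductorNorm ℤ) :
    ¬ (q : ℤ) ∣ D.maninConstant := by
  set d : ℤ := (-1 : ℤ) ^ (q / 2) * q with hd
  have hdZ : d ≠ 0 := mul_ne_zero (pow_ne_zero _ (by norm_num)) (by exact_mod_cast hq.ne_zero)
  have hd0 : (d : ℚ) ≠ 0 := by exact_mod_cast hdZ
  -- the twist `Q = W ⊗ χ_{q*}` of `W` itself is isogenous to `W'`
  set Q : WeierstrassCurve ℚ := W.quadraticTwist (d : ℚ) with hQ
  haveI hQell : Q.IsElliptic := W.isElliptic_quadraticTwist hd0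
  have hQW' : IsIsogenous Q W' := by
    have h1 : IsIsogenous Q ((W'.quadraticTwist (d : ℚ)).quadraticTwist (d : ℚ)) :=
      hiso.quadraticTwist hd0
    obtain ⟨C, hC⟩ := exists_quadraticTwist_quadraticTwist_eq_smul W' hd0
    rw [hC] at h1
    exact h1.trans' (isIsogenous_of_smul W' C)
  -- conductors agree (modularity), so `f_q(Q) ≤ 1`
  have hmod : nonempty_modularParametrizationData :=
    nonempty_modularParametrizationData_iff_exists_isNewformOf_unconditional.mpr hnf
  have hNQ : Q.conductorNorm ℤ = W'.conductorNorm ℤ :=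
    conductorNorm_eq_of_isIsogenous_of_modularity hmod Q W' hQW'
  set vq : HeightOneSpectrum ℤ := (primesEquiv (R := ℤ)).symm ⟨q, hq⟩ with hvq
  have hN'0 : W'.conductorNorm ℤ ≠ 0 := (conductorNorm_pos_holds W').ne'
  have hfac : (W'.conductorNorm ℤ).factorization q ≤ 1 := by
    by_contra hlt
    exact hqN' ((hq.pow_dvd_iff_le_factorization hN'0).mpr (by omega))
  have hfQ : Q.conductorExponent vq ≤ 1 := by
    rw [hvq, ← factorization_conductorNorm_primesEquiv_symm Q ⟨q, hq⟩, hNQ]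
    exact hfac
  have hsemi : Q.HasGoodReductionAt vq ∨ Q.HasMultiplicativeReductionAt vq := by
    rcases hasGoodReductionAt_or_hasMultiplicativeReductionAt_or_hasAdditiveReductionAt vq Q with
      hg | hm | ha
    · exact Or.inl hg
    · exact Or.inr hm
    · exact absurd (((two_le_conductorExponent_iff_holds vq Q).mpr ha).trans hfQ) (by norm_num)
  exact not_dvd_maninConstant_of_isSemistableAt_quadraticTwist_pStar hM hAU hC2 hnf D hopt hq hq2
    hqN hsemi

/-- **All odd primes at once, in the shape of the route's cruxes** (C3 at `q = 3`, the residual C5 at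
`q ≥ 5`): under the four fact binders, for a lattice-optimal `X₀(N)`-datum of a globally minimal `W`
and an odd prime `q` with `q² ∣ N`, a displayed elliptic `W'` with `W ∼ W' ⊗ χ_{q*}` and
`q² ∤ N(W')` certifies `q ∤ c`. [cite: Stevens1989, Lemmas (5.2), (5.4)] [cite: Cesnavicius2018, Thm. 1.2] -/
theorem not_dvd_maninConstant_of_exists_isIsogenous_twist
    (hM : mazur_not_dvd_maninConstant_of_odd)
    (hAU : abbesUllmo_not_dvd_maninConstant_of_not_dvd_level)
    (hC2 : cesnavicius_not_two_dvd_maninConstant_of_two_dvd_level) (hnf : exists_isNewformOf)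
    (W : WeierstrassCurve ℚ) [W.IsElliptic] [W.IsGloballyMinimal] {N : ℕ} [NeZero N]
    (D : ModularParametrizationData W N)
    (hopt : ∀ z ∈ D.L.lattice, ∃ w ∈ periodLattice D.f, z = D.c * w)
    {q : ℕ} (hq : q.Prime) (hq2 : q ≠ 2) (hqN : q ^ 2 ∣ N)
    (hex : ∃ W' : WeierstrassCurve ℚ, W'.IsElliptic ∧
      IsIsogenous W (W'.quadraticTwist (((-1 : ℤ) ^ (q / 2) * q : ℤ) : ℚ)) ∧
      ¬ q ^ 2 ∣ W'.conductorNorm ℤ) :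
    ¬ (q : ℤ) ∣ D.maninConstant := by
  obtain ⟨W', hE', hiso, hqN'⟩ := hex
  haveI := hE'
  exact not_dvd_maninConstant_of_isIsogenous_twist_of_not_sq_dvd hM hAU hC2 hnf hq hq2 W D hopt hqN
    W' hiso hqN'

end Summit.BirchSwinnertonDyer.BirchSwinnertonDyer.Theorems.ManinLocalTwoThree

end
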